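import Summits.ResolutionOfSingularities.ResolutionOfSingularities.Theorems.PurelyInseparableDim4JointWaitingNodeDefsTwo
import HarnessLib

/-!
# Purely inseparable four-folds: NAMES for the node data of the joint forest with HEREDITARY waiting members (brick S3 (c) «joint
# point∘coordinate chains», part 60 = v3-H, definitions; cell `res-dim4-pi`)

[OURS · counted 0] (D-0157 DOOR 2; desk WORD #66 (4)(c), #74 (g), #99 (d); frame `PIDim4.TerminationImpliesOrderReduction`, S3 (c) v3;
host item stmt-ResolutionOfSingularities-16155, helper). Nothing here proves resolution of singularities in dimension ≥ 4 / characteristic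
`p` — NOT here, not anywhere in this programme. NO theorem content: ABBREVIATING DEFINITIONS (predicates with explicit parameters, no axioms,
no cited fact) for the v3-H chain (parts 58 ff.), the format in which a CHILD of the forest may itself host waiting members («hereditary
waiting»: the order-`p` locus inside the new exceptional divisor over a blown-up member has intersecting translated coordinate components —
one is the child, the others WAIT on it; the designed limit of the threading chain 49–55, where children are born with empty waiting sets).

Differences to parts 49/49b: (i) waiting regions are the translated COORDINATE SUBSPACES `V(z, x_T − c_T)` (`waitingSetZ`, with the `z`
condition — closed in the blown-up ambient when hosted inside an exceptional divisor, part 58); (ii) ONE table `wplan : State → Finset → Finset`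
of waiting entries per combinatorial node (a member's own entries are `wplan s S`), ONE edge relation `HEdge` = child edges ∪ waiting-kid edges;
(iii) the boundary conditions of a waiting entry and of a member are MODEL-FREE and hereditary: «every boundary component meeting the waiting
region contains the member and the region», «every boundary component meeting the member contains it» (the latter only asked when hereditary
entries occur strictly below); (iv) the block at a pair carries the waiting entries' admissibility with HOST-level permissibility
(`V(z, x_T)` permissible for `s.F(x + c)`, parts 31/55a), the hereditary side conditions of the children's entries (`wt.1 ∉ S`, chart index
`∈ T` with offset `0`; no hereditary entries below a waiting kid), their separations, and a FOUR-WAY normalised cover (child / own waiting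
entry / a child's hereditary entry / leaf).

* `waitingSetZ`, `mem_waitingSetZ_iff` · `HEdge` · `BlockH` · `MemberChartZ` · `MemberDataH`.

AI-produced formalisation, weaker than expert review. bears_on: LADDER-RESOLUTION:D157-DOOR2 (res-dim4-pi · S3 (c) joint v3-H · defs).
-/

set_option linter.dupNamespace false -- D-0017: single-problem summit path `Summit.<S>.<S>.…` by design

noncomputable section

open MvPolynomial Finset CategoryTheory AlgebraicGeometry Opposite TopologicalSpace
open AlgebraicGeometry.Scheme.IdealSheafData (ofIdealTop vanishingIdeal)

namespace Summit.ResolutionOfSingularities.ResolutionOfSingularities.Theorems.PIDim4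

open Literature.AlgebraicGeometry.Resolution
open Literature.AlgebraicGeometry.Resolution.Hauser2010
open Literature.AlgebraicGeometry.Resolution.AffinePointBlowup (P A γ coord Wtop ξ)

namespace Equimultiple

section DefsH

variable {K : Type} [Field K] (p : ℕ) [DecidableEq K]

omit [DecidableEq K] in
/-- **The waiting coordinate subspace (`z`-form)** of a waiting entry `wt = (j, c, T)`: `V(z, x_i − c_i : i ∈ T) ⊆ 𝔸⁵` in host-relative
coordinates — the waiting MEMBER lies on it because `V(z, x_T)` is permissible for the host state translated to `c` (part 58 §1).
[cite: Hauser2010, §G (translated coordinate subspaces)] -/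
def waitingSetZ (wt : Fin 4 × (Fin 4 → K) × Finset (Fin 4)) : Set (P 4 K) :=
  {x : P 4 K | (X 0 : A 4 K) ∈ x.asIdeal ∧ ∀ i ∈ wt.2.2, (X i.succ - C (wt.2.1 i) : A 4 K) ∈ x.asIdeal}

omit [DecidableEq K] in
/-- Membership in the `z`-form waiting coordinate subspace, unfolded. [folklore] -/
theorem mem_waitingSetZ_iff (wt : Fin 4 × (Fin 4 → K) × Finset (Fin 4)) (x : P 4 K) :
    x ∈ waitingSetZ wt ↔ (X 0 : A 4 K) ∈ x.asIdeal ∧ ∀ i ∈ wt.2.2, (X i.succ - C (wt.2.1 i) : A 4 K) ∈ x.asIdeal := Iff.rfl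

/-- **The edge relation of the combinatorial forest with hereditary waiting**: `HEdge p plan wplan q′ q` iff `q′ = (step p S t.1 t.2.1 s, t.2.2)`
for a plan entry (CHILD edge) or a waiting entry (WAITING-KID edge) `t` of `q = (s, S)` — «`q′` lies directly below `q`» (first argument the
lower pair, the orientation `Acc` wants; reachability downwards is `ReflTransGen` of the flip). Termination of the node theorem is `CutExpand`
on the members' pairs. [cite: BierstoneGrigorievMilmanWlodarczyk2011, §4 Step 2b] -/
def HEdge (plan wplan : State K → Finset (Fin 4) → Finset (Fin 4 × (Fin 4 → K) × Finset (Fin 4)))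
    (q' q : State K × Finset (Fin 4)) : Prop :=
  (∃ e ∈ plan q.1 q.2, q' = (CentreBlowup.step p q.2 e.1 e.2.1 q.1, e.2.2)) ∨
    ∃ wt ∈ wplan q.1 q.2, q' = (CentreBlowup.step p q.2 wt.1 wt.2.1 q.1, wt.2.2)

/-- **The block of conditions AT a pair `q = (s, S)` of the forest with hereditary waiting** (all in model terms):
(P1) admissible plan entries `(j, b, S″)` (`j ∈ S`, `b_j = 0`, `S ⊆ S″`, equimultiple, child-permissible); (P2) separated plan entries;
(P3) leaf point walks; (W1) admissible waiting entries `(j, c, T)` (`j ∈ S`, `c|_S = 0`, `c` supported on `T`, `S ∖ {j} ⊆ T ∌ j`, `V(z, x_T)`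
permissible for `s.F(x + c)`); (W2)/(PW) same-chart separations waiting/waiting and plan/waiting; (H1) hereditary side conditions of the
CHILDREN's waiting entries (`wt.1 ∉ S`, the child's chart index lies in `wt.T` with offset `0`); (H0) no waiting entries at or below a waiting
kid; (H2) separations of the children's hereditary regions from the other children, from the own waiting entries (same chart), and from
each other; (P5) the FOUR-WAY normalised cover: every normalised equimultiple pair `(j′, b′)` agrees with a plan entry of its chart on `S″`,
or with an own waiting entry of its chart on `T`, or with a hereditary entry of a child of its chart on `T` (offsets added), or is a leaf.
[cite: BierstoneGrigorievMilmanWlodarczyk2011, Def. 3.1.3; §4 Step 2b] [cite: Hauser2010, §§F–G] -/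
def BlockH (plan : State K → Finset (Fin 4) → Finset (Fin 4 × (Fin 4 → K) × Finset (Fin 4)))
    (leaves : State K → Finset (Fin 4) → Finset (Fin 4 × (Fin 4 → K)))
    (wplan : State K → Finset (Fin 4) → Finset (Fin 4 × (Fin 4 → K) × Finset (Fin 4))) (q : State K × Finset (Fin 4)) : Prop :=
  -- (P1) admissible plan entries
  (∀ e ∈ plan q.1 q.2, e.1 ∈ q.2 ∧ e.2.1 e.1 = 0 ∧ q.2 ⊆ e.2.2 ∧
      CentreBlowup.IsEquimultiplePoint p q.2 e.1 e.2.1 q.1 ∧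
      IsPermissibleCentre p e.2.2 (CentreBlowup.step p q.2 e.1 e.2.1 q.1).F) ∧
  -- (P2) separated plan entries
  (∀ e ∈ plan q.1 q.2, ∀ e' ∈ plan q.1 q.2, e ≠ e' →
      (e.1 = e'.1 ∧ ∃ i ∈ e.2.2, i ∈ e'.2.2 ∧ e.2.1 i ≠ e'.2.1 i) ∨
      (e.1 ≠ e'.1 ∧ ((e'.2.1 e.1 = 0 ∧ e.1 ∈ e'.2.2) ∨ (e.2.1 e'.1 = 0 ∧ e'.1 ∈ e.2.2)))) ∧
  -- (P3) leaf point walks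
  (∀ l ∈ leaves q.1 q.2, CentreBlowup.IsEquimultiplePoint p q.2 l.1 l.2 q.1 →
      Acc (fun s' s : State K => Edge p Finset.univ s s') (CentreBlowup.step p q.2 l.1 l.2 q.1) ∧
      ∀ s' : State K, Relation.ReflTransGen (fun a e : State K => Edge p Finset.univ a e)
          (CentreBlowup.step p q.2 l.1 l.2 q.1) s' →
        {jb : Fin 4 × (Fin 4 → K) | jb.2 jb.1 = 0 ∧ CentreBlowup.IsEquimultiplePoint p Finset.univ jb.1 jb.2 s'}.Finite) ∧
  -- (W1) admissible waiting entries, HOST-level permissibility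
  (∀ wt ∈ wplan q.1 q.2, wt.1 ∈ q.2 ∧ (∀ i ∈ q.2, wt.2.1 i = 0) ∧ (∀ i ∉ wt.2.2, wt.2.1 i = 0) ∧ q.2.erase wt.1 ⊆ wt.2.2 ∧
      wt.1 ∉ wt.2.2 ∧ IsPermissibleCentre p wt.2.2 (PointBlowup.translate wt.2.1 q.1.F)) ∧
  -- (W2) waiting entries of one chart are separated
  (∀ wt ∈ wplan q.1 q.2, ∀ wt' ∈ wplan q.1 q.2, wt ≠ wt' → wt.1 = wt'.1 → ∃ i ∈ wt.2.2, i ∈ wt'.2.2 ∧ wt.2.1 i ≠ wt'.2.1 i) ∧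
  -- (PW) plan entries are separated from the waiting entries of their chart
  (∀ e ∈ plan q.1 q.2, ∀ wt ∈ wplan q.1 q.2, e.1 = wt.1 → ∃ i ∈ e.2.2, i ∈ wt.2.2 ∧ e.2.1 i ≠ wt.2.1 i) ∧
  -- (H1) hereditary side conditions of the children's waiting entries
  (∀ e ∈ plan q.1 q.2, ∀ wt ∈ wplan (CentreBlowup.step p q.2 e.1 e.2.1 q.1) e.2.2,
      wt.1 ∉ q.2 ∧ e.1 ∈ wt.2.2 ∧ wt.2.1 e.1 = 0) ∧
  -- (H0) no waiting entries at or below a waiting kid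
  (∀ wt₀ ∈ wplan q.1 q.2, ∀ q' : State K × Finset (Fin 4),
      Relation.ReflTransGen (fun a b : State K × Finset (Fin 4) => HEdge p plan wplan b a)
        (CentreBlowup.step p q.2 wt₀.1 wt₀.2.1 q.1, wt₀.2.2) q' → wplan q'.1 q'.2 = ∅) ∧
  -- (H2a) a child's hereditary region is separated from the other children
  (∀ e ∈ plan q.1 q.2, ∀ wt ∈ wplan (CentreBlowup.step p q.2 e.1 e.2.1 q.1) e.2.2, ∀ e' ∈ plan q.1 q.2, e' ≠ e →
      (e'.1 = e.1 ∧ ∃ i ∈ wt.2.2, i ∈ e'.2.2 ∧ e.2.1 i + wt.2.1 i ≠ e'.2.1 i) ∨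
      (e'.1 ≠ e.1 ∧ ((e'.2.1 e.1 = 0 ∧ e.1 ∈ e'.2.2) ∨ (e.2.1 e'.1 + wt.2.1 e'.1 = 0 ∧ e'.1 ∈ wt.2.2)))) ∧
  -- (H2b) … from the own waiting entries of the same chart
  (∀ e ∈ plan q.1 q.2, ∀ wt ∈ wplan (CentreBlowup.step p q.2 e.1 e.2.1 q.1) e.2.2, ∀ wt₀ ∈ wplan q.1 q.2, wt₀.1 = e.1 →
      ∃ i ∈ wt.2.2, i ∈ wt₀.2.2 ∧ e.2.1 i + wt.2.1 i ≠ wt₀.2.1 i) ∧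
  -- (H2c) … and from the other hereditary regions
  (∀ e ∈ plan q.1 q.2, ∀ wt ∈ wplan (CentreBlowup.step p q.2 e.1 e.2.1 q.1) e.2.2,
    ∀ e' ∈ plan q.1 q.2, ∀ wt' ∈ wplan (CentreBlowup.step p q.2 e'.1 e'.2.1 q.1) e'.2.2, (e, wt) ≠ (e', wt') →
      (e'.1 = e.1 ∧ ∃ i ∈ wt.2.2, i ∈ wt'.2.2 ∧ e.2.1 i + wt.2.1 i ≠ e'.2.1 i + wt'.2.1 i) ∨
      (e'.1 ≠ e.1 ∧ ((e'.2.1 e.1 + wt'.2.1 e.1 = 0 ∧ e.1 ∈ wt'.2.2) ∨ (e.2.1 e'.1 + wt.2.1 e'.1 = 0 ∧ e'.1 ∈ wt.2.2)))) ∧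
  -- (P5) FOUR-WAY normalised cover
  (∀ (j' : Fin 4) (b' : Fin 4 → K), j' ∈ q.2 → b' j' = 0 → (∀ k ∈ q.2, k < j' → b' k = 0) →
      CentreBlowup.IsEquimultiplePoint p q.2 j' b' q.1 →
      (∃ e ∈ plan q.1 q.2, e.1 = j' ∧ ∀ i ∈ e.2.2, b' i = e.2.1 i) ∨
      (∃ wt ∈ wplan q.1 q.2, wt.1 = j' ∧ ∀ i ∈ wt.2.2, b' i = wt.2.1 i) ∨
      (∃ e ∈ plan q.1 q.2, e.1 = j' ∧ ∃ wt ∈ wplan (CentreBlowup.step p q.2 e.1 e.2.1 q.1) e.2.2,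
        ∀ i ∈ wt.2.2, b' i = e.2.1 i + wt.2.1 i) ∨
      (j', b') ∈ leaves q.1 q.2)

variable {X' : Scheme.{0}}

omit [DecidableEq K] in
/-- **Chart clause of a coordinate member with `z`-form waiting regions**: part 49's `MemberChart` with `waitingSet` replaced by `waitingSetZ` —
a zigzag chart `X′ ←φ— Y —ψ→ 𝔸⁵` reading `M′` as `(z^p + s.F)·𝒪` and `𝓘(c)` as `𝓘Λ S`, covering `c`, seeing `V(z, x_S)`, carrying the translated
shape of the boundary, and through which every waiting region is seen: `wreg wt = φ(ψ⁻¹ V(z, x_T − c_T))`, `V(z, x_T − c_T) ⊆ ψ(Y)`.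
[cite: BierstoneGrigorievMilmanWlodarczyk2011, Def. 3.1.3 (2), (4)] [cite: Hauser2010, §G] -/
def MemberChartZ (M' : MarkedIdeal X') (c : Closeds X') (s : State K) (S : Finset (Fin 4))
    (Wt : Finset (Fin 4 × (Fin 4 → K) × Finset (Fin 4))) (wreg : Fin 4 × (Fin 4 → K) × Finset (Fin 4) → Closeds X') : Prop :=
  ∃ (Y : Scheme.{0}) (φ : Y ⟶ X') (ψ : Y ⟶ P 4 K) (_ : IsOpenImmersion φ) (_ : IsOpenImmersion ψ),
    M'.ideal.comap φ = (hypSheaf p s.F).comap ψ ∧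
    (vanishingIdeal c).comap φ = (AffineCoordBlowup.𝓘Λ 4 K (insert 0 (Fin.succ '' (S : Set (Fin 4))))).comap ψ ∧
    (c : Set X') ⊆ Set.range φ ∧
    (AffineCoordBlowup.CΛ 4 K (insert 0 (Fin.succ '' (S : Set (Fin 4)))) : Set (P 4 K)) ⊆ Set.range ψ ∧
    (∃ (idx : X'.IdealSheafData → Fin 4) (cst_ : X'.IdealSheafData → K),
      (∀ D ∈ M'.boundary,
        ((D.support : Set X') ∩ φ '' (ψ ⁻¹'
          (AffineCoordBlowup.CΛ 4 K (insert 0 (Fin.succ '' (S : Set (Fin 4)))) : Set (P 4 K)))).Nonempty →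
        D.comap φ = (ofIdealTop (Ideal.span {(γ 4 K).symm (X (idx D).succ + C (cst_ D))})).comap ψ ∧ (idx D ∈ S → cst_ D = 0)) ∧
      (∀ D₁ ∈ M'.boundary, ∀ D₂ ∈ M'.boundary,
        ((D₁.support : Set X') ∩ φ '' (ψ ⁻¹'
          (AffineCoordBlowup.CΛ 4 K (insert 0 (Fin.succ '' (S : Set (Fin 4)))) : Set (P 4 K)))).Nonempty →
        ((D₂.support : Set X') ∩ φ '' (ψ ⁻¹'
          (AffineCoordBlowup.CΛ 4 K (insert 0 (Fin.succ '' (S : Set (Fin 4)))) : Set (P 4 K)))).Nonempty →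
        idx D₁ = idx D₂ → D₁ = D₂)) ∧
    ∀ wt ∈ Wt, (wreg wt : Set X') = φ '' (ψ ⁻¹' waitingSetZ wt) ∧ waitingSetZ wt ⊆ Set.range ψ

/-- **The full datum of a COORDINATE MEMBER `c` of a node in the forest with hereditary waiting** (state `s`, centre `S`, own waiting entries
`wplan s S` with regions `wr`): basics (`s.F ≠ 0` clean, `S` permissible, `c` regular, snc with the boundary) · `MemberChartZ` · `BlockH` at EVERY pair
reachable along `HEdge` from `(s, S)` (the own pair included) · `Acc` of the flipped edge relation at `(s, S)` · for each own waiting entry the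
model-free boundary invariant «every boundary component meeting the region contains `c` and the region» · if some hereditary waiting entry
occurs strictly below a child: «every boundary component meeting `c` contains `c`».
[cite: BierstoneGrigorievMilmanWlodarczyk2011, Def. 3.1.3] [cite: Hauser2010, §§F–G] -/
def MemberDataH [IsAlgClosed K] [CharP K p] [Fact p.Prime]
    (plan : State K → Finset (Fin 4) → Finset (Fin 4 × (Fin 4 → K) × Finset (Fin 4)))
    (leaves : State K → Finset (Fin 4) → Finset (Fin 4 × (Fin 4 → K)))
    (wplan : State K → Finset (Fin 4) → Finset (Fin 4 × (Fin 4 → K) × Finset (Fin 4)))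
    (M' : MarkedIdeal X') (c : Closeds X') (s : State K) (S : Finset (Fin 4))
    (wr : Fin 4 × (Fin 4 → K) × Finset (Fin 4) → Closeds X') : Prop :=
  s.F ≠ 0 ∧ Literature.Barriers.ResolutionOfSingularities.HauserPerlega.IsClean p s.F ∧ IsPermissibleCentre p S s.F ∧
  Scheme.IsRegular (vanishingIdeal c).subscheme ∧ HasSNCWith M'.boundary (vanishingIdeal c) ∧
  MemberChartZ p M' c s S (wplan s S) wr ∧
  (∀ q : State K × Finset (Fin 4),
    Relation.ReflTransGen (fun a b : State K × Finset (Fin 4) => HEdge p plan wplan b a) (s, S) q → BlockH p plan leaves wplan q) ∧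
  Acc (fun q' q : State K × Finset (Fin 4) => HEdge p plan wplan q' q) (s, S) ∧
  (∀ wt ∈ wplan s S, ∀ D ∈ M'.boundary,
    Disjoint (D.support : Set X') (wr wt : Set X') ∨ ((c : Set X') ⊆ D.support ∧ (wr wt : Set X') ⊆ D.support)) ∧
  ((∃ e ∈ plan s S, ∃ q : State K × Finset (Fin 4),
      Relation.ReflTransGen (fun a b : State K × Finset (Fin 4) => HEdge p plan wplan b a)
        (CentreBlowup.step p S e.1 e.2.1 s, e.2.2) q ∧ (wplan q.1 q.2).Nonempty) →
    ∀ D ∈ M'.boundary, ((D.support : Set X') ∩ (c : Set X')).Nonempty → (c : Set X') ⊆ D.support)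

end DefsH

end Equimultiple

end Summit.ResolutionOfSingularities.ResolutionOfSingularities.Theorems.PIDim4

end
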